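import Mathlib.Analysis.Complex.Basic
import Mathlib.Analysis.Convex.Hull
import Mathlib.Data.ENNReal.Inv
import Mathlib.Data.Fin.Tuple.Basic
import Mathlib.LinearAlgebra.Matrix.Hermitian
import Literature.Computability.Cryptography.QubitRegister
import HarnessLib

/-!
# LOCC-tree (adaptive) orthonormal product bases of `n` qubits, the tree-frame norm, and the
# two-sided radius of a body of operators

Definitions requested by route `SeparableFrames` of `Summits/QuantumAdvantage` (item
`defn-TreeProductFrames`; cruxes `FrameDilationPolynomial`, `FrameTrackingAlgorithm`,
`TwoQubitFrameExactness`), in the register conventions of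
`Literature.Computability.Cryptography.QubitRegister` (`QReg n = Fin n → Bool`, state vectors
`QReg n → ℂ`, operators `Matrix (QReg n) (QReg n) ℂ`, rank-one operators
`Matrix.vecMulVec ψ (star ψ) = |ψ⟩⟨ψ|`).

## Contents

* `IsQubitONB u` — `(u false, u true)` is an orthonormal basis of `ℂ²` (Gram form), and
  `isQubitONB_iff` (the "unit vectors + one orthogonality" form used inline by the route).
* `IsTreeProductBasis n e` — the labelled family `e : QReg n → (QReg n → ℂ)` is an ADAPTIVE
  (LOCC-tree, one-way local) ORTHONORMAL PRODUCT BASIS of `(ℂ²)^{⊗ n}`, by recursion on `n`: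
  some wire `i` is measured first in an orthonormal basis `u` of its qubit, and for each outcome
  `b` the remaining `n - 1` wires carry a tree basis `f b` (which chooses its own first wire, and
  so on); the vector with label `y` is `u_{y i} ⊗ (f (y i))_{y ∖ i}`. For `n = 2` these are ALL
  orthonormal product bases (Walgate–Hardy 2002, Thm. 1 and Thm. 4 with eq. (4)–(4.1): four
  orthogonal two-qubit product states have the form `|0⟩|φ⟩, |0⟩|φ^⊥⟩, |1⟩|θ⟩, |1⟩|θ^⊥⟩` for one
  of the two parties going first); from `n = 3` on they are a strict subclass of the orthonormal
  product bases (completions of the Shifts unextendible product basis are not LOCC-measurable,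
  Bennett et al. 1999) — neither fact is vendored here.
  API: `isTreeProductBasis_zero_iff`, `isTreeProductBasis_succ_iff` (unfolding),
  `isTreeProductBasis_basisState` (the computational basis is one),
  `IsTreeProductBasis.sum_star_mul` (orthonormality `⟨e_y, e_{y'}⟩ = [y = y']`),
  `IsTreeProductBasis.sum_mul_star` (completeness `∑_y |e_y⟩⟨e_y| = 1`, entrywise).
* `frameDiagonal e ε = ∑_y ε_y |e_y⟩⟨e_y|`, `treeDiagonalContractions n` (those with `e` a tree
  basis and `ε_y ∈ [-1, 1]`: the operators `2M - 1` of the two-outcome LOCC-tree projective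
  measurements and their convex relaxation in `ε`), `treeFrameBody n = conv(treeDiagonalContractions n)`
  (the symmetric convex body `𝒫ₙ` attached to this measurement class as in
  Matthews–Wehner–Winter, Lemma 2).
* `atomicWeights 𝒟 x`, `atomicGauge 𝒟 x = inf {∑ₖ |cₖ| : x = ∑ₖ cₖ • aₖ, aₖ ∈ 𝒟, cₖ ∈ ℝ}` — the
  `ℓ¹`-atomic gauge of a set `𝒟` in a complex vector space (the Minkowski gauge of
  `conv(𝒟 ∪ -𝒟)`, i.e. the norm `‖·‖` with unit ball that body, Matthews–Wehner–Winter Remark 3),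
  with `atomicGauge_nonneg`, `atomicGauge_le`, `atomicGauge_zero`.
* `treeFrameNorm T = atomicGauge (treeDiagonalContractions n) T` — the TREE-FRAME NORM `a(T)`:
  least `ℓ¹`-weight `∑ₖ |cₖ|` of a decomposition `T = ∑ₖ cₖ Dₖ` into real-diagonal contractions
  in LOCC-tree bases (the gauge of `𝒫ₙ`); `treeFrameNorm_nonneg`, `treeFrameNorm_le`,
  `treeFrameNorm_zero`, `neg_mem_treeDiagonalContractions`.
* `symmRadius K T = sup {β ≥ 0 : 1 + βT ∈ K ∧ 1 - βT ∈ K}` in `ℝ≥0∞` — the TWO-SIDED RADIUS of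
  a set `K` of operators in direction `T`; for `K` the cone of fully separable operators this is
  the symmetric separable radius `s_sym(T)`, the reciprocal of the gauge of the body
  `𝕊𝔼ℙ = {A : 1 ± A separable}` of Matthews–Wehner–Winter (Lemma 2, Remark 3, §3);
  `le_symmRadius`, `ofReal_le_symmRadius`, `symmRadius_mono`, `symmRadius_zero_of_one_mem`.

## Design notes

* The fully separable cone is the SEPARATE item `defn-FullySeparableCone` (same directory and
  namespace); to avoid a duplicate declaration this file keeps the radius generic in the body
  `K`, and the route's `sepRadiusSym T` is the term `symmRadius (FullySeparableCone n) T`; the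
  dilation constant of the route is `κₙ = sup_T treeFrameNorm T * symmRadius (FullySeparableCone n) T`
  (not defined here; the crux quantifies over `T` directly).
* Scalars follow the route's inline convention: real coefficients act through the cast
  `((c : ℝ) : ℂ) • M`, never through an `ℝ`-module instance on complex matrices.
* `symmRadius` is `ℝ≥0∞`-valued so that `symmRadius K 0 = ⊤` (all `β` qualify once `1 ∈ K`) is
  faithful; a real-valued `sSup` would return the junk value `0` there.
* JUNK VALUE (documented): `treeFrameNorm T = sInf ∅ = 0` when `T` admits no decomposition at
  all (e.g. `T` not Hermitian); every Hermitian `T` has one (Pauli strings are `±1`-diagonal in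
  non-adaptive product bases), a fact not proved here. The infimum over decompositions of a fixed
  finite length is attained by compactness (not proved here); statements needing a witness should
  say "`∃` decomposition of weight `≤ c`" or use `treeFrameNorm_le`.
* Labelling convention: the label bit `y i` of `e_y` IS the outcome index of the first
  measurement; relabellings within the tree are absorbed by the free choice of `u` and `f`, and
  all uses (`∑_y ε_y |e_y⟩⟨e_y|` with arbitrary `ε`) are invariant under them. Base case `n = 0`:
  the unique vector is the scalar `1` (phases are likewise absorbed by `u`).
* Mathlib/tree searched (`lean search`): no `ProductBasis`, `IsProductVec`, `atomicNorm`,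
  `sepRadius`, LOCC or separable-cone declarations; Mathlib's `gauge` (real vector spaces, sets)
  is the abstract Minkowski functional — `atomicGauge` is kept in the explicit finite-decomposition
  form the route's statements quantify over.

## References

* [WalgateHardy2002] J. Walgate, L. Hardy, *Nonlocality, asymmetry, and distinguishing bipartite
  states*, Phys. Rev. Lett. 89 (2002) 147901 = arXiv:quant-ph/0202034: Thm. 1 (2 × n, the qubit
  holder going first), Thms. 3–4 and eqs. (3), (4), (4.1) (read via `lit read`, pp. 2–4).
* [MatthewsWehnerWinter2009] W. Matthews, S. Wehner, A. Winter, *Distinguishability of quantum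
  states under restricted families of measurements…*, Comm. Math. Phys. 291 (2009) 813–843 =
  arXiv:0810.2327: §1 Lemma 2, Remark 3, Thm. 4 (bodies `𝕄`, gauge and dual norms), §3 (classes
  `LO ⊂ LOCC ⊂ SEP ⊂ PPT` and their bodies) — arXiv section numbering (read via `lit read`,
  pp. 4–5, 10).
* C. H. Bennett et al., *Unextendible product bases and bound entanglement*, Phys. Rev. Lett. 82
  (1999) 5385 (context only).
-/

noncomputable section

open scoped BigOperators ENNReal NNReal

namespace Literature.Computability.QuantumComplexity

open Literature.Computability.Cryptography (QReg basisState basisState_apply)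

/-! ### Orthonormal bases of one qubit -/

/-- `IsQubitONB u`: the two vectors `u false, u true : Bool → ℂ` of `ℂ²` (outcome label first,
component second) form an orthonormal basis, stated through the Gram matrix
`∑ₜ conj (u a t) · u b t = [a = b]`. (Nielsen–Chuang §2.1.4.) [folklore] -/
def IsQubitONB (u : Bool → Bool → ℂ) : Prop :=
  ∀ a b : Bool, ∑ t : Bool, star (u a t) * u b t = if a = b then 1 else 0

/-- The Gram form of `IsQubitONB` versus the "two unit vectors, one orthogonality relation" form
written inline in route `SeparableFrames` (`TwoQubitFrameExactness`). [folklore] -/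
theorem isQubitONB_iff (u : Bool → Bool → ℂ) :
    IsQubitONB u ↔
      (∀ a : Bool, ∑ t : Bool, ‖u a t‖ ^ 2 = 1) ∧ ∑ t : Bool, star (u false t) * u true t = 0 := by
  have hdiag : ∀ a : Bool,
      (∑ t : Bool, star (u a t) * u a t) = ((∑ t : Bool, ‖u a t‖ ^ 2 : ℝ) : ℂ) := by
    intro a
    push_cast
    refine Finset.sum_congr rfl fun t _ => ?_
    rw [Complex.star_def, Complex.conj_mul']
  constructor
  · intro h
    refine ⟨fun a => ?_, by simpa using h false true⟩
    have := h a a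
    rw [hdiag a, if_pos rfl] at this
    exact_mod_cast this
  · rintro ⟨hn, ho⟩ a b
    cases a <;> cases b
    · rw [hdiag, hn]; simp
    · simpa using ho
    · have h' := congrArg star ho
      rw [star_sum, star_zero] at h'
      rw [if_neg (by decide), ← h']
      exact Finset.sum_congr rfl fun t _ => by rw [star_mul', star_star, mul_comm]
    · rw [hdiag, hn]; simp

/-- Row-orthonormality of a qubit basis implies column-orthonormality (a `2 × 2` matrix with
orthonormal rows is unitary): `∑_b u b t · conj (u b t') = [t = t']`. [folklore] -/
theorem IsQubitONB.sum_mul_star {u : Bool → Bool → ℂ} (hu : IsQubitONB u) (t t' : Bool) :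
    ∑ b : Bool, u b t * star (u b t') = if t = t' then 1 else 0 := by
  -- `U b t := u b t`; the hypothesis says `U * Uᴴ = 1`, hence `Uᴴ * U = 1`.
  set U : Matrix Bool Bool ℂ := Matrix.of fun b t => u b t with hU
  have h1 : U * U.conjTranspose = 1 := by
    ext a b
    rw [Matrix.mul_apply, Matrix.one_apply]
    have := hu b a
    rw [show (if a = b then (1 : ℂ) else 0) = if b = a then 1 else 0 by
      by_cases h : a = b <;> simp [h, eq_comm]]
    rw [← this]
    refine Finset.sum_congr rfl fun t _ => ?_
    simp [hU, Matrix.conjTranspose_apply, mul_comm]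
  have h2 : U.conjTranspose * U = 1 := mul_eq_one_comm.mp h1
  have h3 := congrFun (congrFun h2 t') t
  rw [Matrix.mul_apply, Matrix.one_apply] at h3
  rw [show (if t = t' then (1 : ℂ) else 0) = if t' = t then 1 else 0 by
    by_cases h : t = t' <;> simp [h, eq_comm], ← h3]
  refine Finset.sum_congr rfl fun b _ => ?_
  simp [hU, Matrix.conjTranspose_apply, mul_comm]

/-! ### LOCC-tree orthonormal product bases -/

/-- `IsTreeProductBasis n e`: the family `e : QReg n → (QReg n → ℂ)` of `2ⁿ` vectors, labelled by
bit strings, is an **adaptive (LOCC-tree) orthonormal product basis** of `n` qubits. Recursion on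
`n`: for `n = 0` the unique vector is the scalar `1`; for `n + 1` wires there are a wire `i`
(measured first), an orthonormal basis `u` of that qubit and, for each outcome `b`, a tree basis
`f b` of the remaining `n` wires, such that
`e y z = u (y i) (z i) * f (y i) (y ∖ i) (z ∖ i)` (`∖ i` = `Fin.removeNth i`), i.e.
`e_y = u_{y i} ⊗ᵢ (f (y i))_{y ∖ i}`. These are the bases measurable by one-way local projective
measurements with classical feed-forward; for two qubits they are all orthonormal product bases
(Walgate–Hardy 2002, Thm. 1 and Thm. 4, eqs. (4)–(4.1)). [folklore] -/
def IsTreeProductBasis : (n : ℕ) → (QReg n → QReg n → ℂ) → Prop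
  | 0, e => ∀ y z, e y z = 1
  | n + 1, e => ∃ (i : Fin (n + 1)) (u : Bool → Bool → ℂ) (f : Bool → QReg n → QReg n → ℂ),
      IsQubitONB u ∧ (∀ b, IsTreeProductBasis n (f b)) ∧
        ∀ y z, e y z = u (y i) (z i) * f (y i) (Fin.removeNth i y) (Fin.removeNth i z)

/-- Unfolding at `n = 0`: the single basis vector is the scalar `1`. [folklore] -/
theorem isTreeProductBasis_zero_iff (e : QReg 0 → QReg 0 → ℂ) :
    IsTreeProductBasis 0 e ↔ ∀ y z, e y z = 1 :=
  Iff.rfl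

/-- Unfolding at `n + 1`: first wire `i`, its basis `u`, conditional sub-bases `f b`. [folklore] -/
theorem isTreeProductBasis_succ_iff {n : ℕ} (e : QReg (n + 1) → QReg (n + 1) → ℂ) :
    IsTreeProductBasis (n + 1) e ↔
      ∃ (i : Fin (n + 1)) (u : Bool → Bool → ℂ) (f : Bool → QReg n → QReg n → ℂ),
        IsQubitONB u ∧ (∀ b, IsTreeProductBasis n (f b)) ∧
          ∀ y z, e y z = u (y i) (z i) * f (y i) (Fin.removeNth i y) (Fin.removeNth i z) :=
  Iff.rfl

/-- The computational basis `(|0⟩, |1⟩)` of one qubit is orthonormal. [folklore] -/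
theorem isQubitONB_std : IsQubitONB fun b t => if t = b then 1 else 0 := by
  intro a b
  cases a <;> cases b <;> simp

/-- One qubit: an orthonormal basis `u` of `ℂ²`, read on wire `0`, is a tree basis. [folklore] -/
theorem isTreeProductBasis_one {u : Bool → Bool → ℂ} (hu : IsQubitONB u) :
    IsTreeProductBasis 1 fun y z => u (y 0) (z 0) :=
  ⟨0, u, fun _ _ _ => 1, hu, fun _ _ _ => rfl, fun y z => by simp⟩

/-- Two qubits: wire `i` first in the basis `u`, then the other wire `j` in the basis `v a`
chosen by the first outcome `a`; the vectors are `y ↦ u_{y i} ⊗ v_{y i, y j}` — the form of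
Walgate–Hardy's Thm. 4, eqs. (4)–(4.1), and of the route's inline `TwoQubitFrameExactness`.
[folklore] -/
theorem isTreeProductBasis_two {i j : Fin 2} (hij : i ≠ j) {u : Bool → Bool → ℂ}
    {v : Bool → Bool → Bool → ℂ} (hu : IsQubitONB u) (hv : ∀ a, IsQubitONB (v a)) :
    IsTreeProductBasis 2 fun y z => u (y i) (z i) * v (y i) (y j) (z j) := by
  have hj : j = i.succAbove 0 := by
    fin_cases i <;> fin_cases j <;> first | exact absurd rfl hij | decide
  subst hj
  exact ⟨i, u, fun a y z => v a (y 0) (z 0), hu, fun a => isTreeProductBasis_one (hv a),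
    fun y z => by simp [Fin.removeNth_apply]⟩

/-- The computational basis `y ↦ |y⟩` is a tree product basis (wire `0` first, standard qubit
basis, recursively). [folklore] -/
theorem isTreeProductBasis_basisState : ∀ n : ℕ, IsTreeProductBasis n fun y => basisState y
  | 0 => fun y z => by
      have h : z = y := Subsingleton.elim _ _
      simp [basisState_apply, h]
  | n + 1 => by
      refine ⟨0, fun b t => if t = b then 1 else 0, fun _ y => basisState y, isQubitONB_std,
        fun _ => isTreeProductBasis_basisState n, fun y z => ?_⟩
      · simp only [basisState_apply, Fin.removeNth_zero]
        by_cases h : z = y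
        · subst h
          simp
        · rw [if_neg h]
          by_cases h0 : z 0 = y 0
          · have ht : Fin.tail z ≠ Fin.tail y := fun ht =>
              h (by rw [← Fin.cons_self_tail z, ← Fin.cons_self_tail y, h0, ht])
            simp [h0, ht]
          · simp [h0]

/-- Splitting a sum over `QReg (n + 1)` along wire `i`: `z ↦ (z i, z ∖ i)` is a bijection
(`Fin.insertNthEquiv`). [folklore] -/
theorem sum_qreg_succ_split {M : Type*} [AddCommMonoid M] {n : ℕ} (i : Fin (n + 1))
    (F : QReg (n + 1) → M) :
    ∑ z, F z = ∑ b : Bool, ∑ z' : QReg n, F (Fin.insertNth i b z') := by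
  rw [← Fintype.sum_prod_type']
  exact (Fintype.sum_equiv (Fin.insertNthEquiv (fun _ => Bool) i)
    (fun p => F (Fin.insertNth i p.1 p.2)) F (fun _ => rfl)).symm

/-- Two labels agree iff they agree at wire `i` and away from it. [folklore] -/
theorem qreg_eq_iff_of_wire {n : ℕ} (i : Fin (n + 1)) (y y' : QReg (n + 1)) :
    y = y' ↔ y i = y' i ∧ Fin.removeNth i y = Fin.removeNth i y' := by
  constructor
  · rintro rfl
    exact ⟨rfl, rfl⟩
  · rintro ⟨hi, hr⟩
    rw [← Fin.insertNth_self_removeNth i y, ← Fin.insertNth_self_removeNth i y', hi, hr]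

/-- **Orthonormality** of a tree product basis: `⟨e_y, e_{y'}⟩ = ∑_z conj (e y z) · e y' z = [y = y']`.
[folklore] -/
theorem IsTreeProductBasis.sum_star_mul :
    ∀ {n : ℕ} {e : QReg n → QReg n → ℂ}, IsTreeProductBasis n e →
      ∀ y y' : QReg n, ∑ z, star (e y z) * e y' z = if y = y' then 1 else 0
  | 0, e, he, y, y' => by
      have hy : y = y' := Subsingleton.elim _ _
      have he' : ∀ y z, e y z = 1 := he
      simp [he', hy]
  | n + 1, e, ⟨i, u, f, hu, hf, he⟩, y, y' => by
      rw [sum_qreg_succ_split i]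
      simp only [he, Fin.insertNth_apply_same, Fin.removeNth_insertNth]
      have hfac : (∑ b : Bool, ∑ z' : QReg n,
          star (u (y i) b * f (y i) (Fin.removeNth i y) z') *
            (u (y' i) b * f (y' i) (Fin.removeNth i y') z')) =
          (∑ b : Bool, star (u (y i) b) * u (y' i) b) *
            ∑ z' : QReg n, star (f (y i) (Fin.removeNth i y) z') *
              f (y' i) (Fin.removeNth i y') z' := by
        rw [Finset.sum_mul_sum]
        refine Finset.sum_congr rfl fun b _ => Finset.sum_congr rfl fun z' _ => ?_
        rw [star_mul']
        ring
      rw [hfac, hu]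
      by_cases hi : y i = y' i
      · rw [if_pos hi, one_mul, ← hi, (hf (y i)).sum_star_mul]
        by_cases hr : Fin.removeNth i y = Fin.removeNth i y'
        · rw [if_pos hr, if_pos ((qreg_eq_iff_of_wire i y y').2 ⟨hi, hr⟩)]
        · rw [if_neg hr, if_neg fun h => hr (by rw [h])]
      · rw [if_neg hi, zero_mul, if_neg fun h => hi (by rw [h])]

/-- **Completeness** of a tree product basis (resolution of the identity, entrywise):
`∑_y e y z · conj (e y z') = [z = z']`, i.e. `∑_y |e_y⟩⟨e_y| = 1`. [folklore] -/
theorem IsTreeProductBasis.sum_mul_star :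
    ∀ {n : ℕ} {e : QReg n → QReg n → ℂ}, IsTreeProductBasis n e →
      ∀ z z' : QReg n, ∑ y, e y z * star (e y z') = if z = z' then 1 else 0
  | 0, e, he, z, z' => by
      have hz : z = z' := Subsingleton.elim _ _
      have he' : ∀ y z, e y z = 1 := he
      simp [he', hz]
  | n + 1, e, ⟨i, u, f, hu, hf, he⟩, z, z' => by
      rw [sum_qreg_succ_split i]
      simp only [he, Fin.insertNth_apply_same, Fin.removeNth_insertNth]
      have hfac : ∀ b : Bool, (∑ y' : QReg n,
          u b (z i) * f b y' (Fin.removeNth i z) * star (u b (z' i) * f b y' (Fin.removeNth i z'))) =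
          u b (z i) * star (u b (z' i)) *
            ∑ y' : QReg n, f b y' (Fin.removeNth i z) * star (f b y' (Fin.removeNth i z')) := by
        intro b
        rw [Finset.mul_sum]
        refine Finset.sum_congr rfl fun y' _ => ?_
        rw [star_mul']
        ring
      simp only [hfac, fun b => (hf b).sum_mul_star (Fin.removeNth i z) (Fin.removeNth i z'),
        ← Finset.sum_mul, hu.sum_mul_star]
      by_cases hi : z i = z' i
      · by_cases hr : Fin.removeNth i z = Fin.removeNth i z'
        · rw [if_pos hi, if_pos hr, one_mul, if_pos ((qreg_eq_iff_of_wire i z z').2 ⟨hi, hr⟩)]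
        · rw [if_neg hr, mul_zero, if_neg fun h => hr (by rw [h])]
      · rw [if_neg hi, zero_mul, if_neg fun h => hi (by rw [h])]

/-- `∑_y |e_y⟩⟨e_y| = 1` for a tree product basis, as a matrix identity. [folklore] -/
theorem IsTreeProductBasis.sum_vecMulVec {n : ℕ} {e : QReg n → QReg n → ℂ}
    (he : IsTreeProductBasis n e) :
    ∑ y, Matrix.vecMulVec (e y) (star (e y)) = (1 : Matrix (QReg n) (QReg n) ℂ) := by
  ext z z'
  rw [Matrix.sum_apply, Matrix.one_apply, ← he.sum_mul_star z z']
  exact Finset.sum_congr rfl fun y _ => by simp [Matrix.vecMulVec_apply]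

/-! ### Tree-diagonal contractions and the tree-frame body -/

/-- `frameDiagonal e ε = ∑_y ε_y |e_y⟩⟨e_y|`: the operator with real "eigenvalue pattern" `ε`
along the family `e`. [folklore] -/
def frameDiagonal {n : ℕ} (e : QReg n → QReg n → ℂ) (ε : QReg n → ℝ) :
    Matrix (QReg n) (QReg n) ℂ :=
  ∑ y, ((ε y : ℂ)) • Matrix.vecMulVec (e y) (star (e y))

/-- Negating the pattern negates the operator. [folklore] -/
theorem frameDiagonal_neg {n : ℕ} (e : QReg n → QReg n → ℂ) (ε : QReg n → ℝ) :
    frameDiagonal e (-ε) = -frameDiagonal e ε := by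
  simp [frameDiagonal, neg_smul, Finset.sum_neg_distrib]

/-- The constant pattern `1` on a tree basis gives the identity (completeness). [folklore] -/
theorem frameDiagonal_one {n : ℕ} {e : QReg n → QReg n → ℂ} (he : IsTreeProductBasis n e) :
    frameDiagonal e (fun _ => 1) = 1 := by
  simp [frameDiagonal, he.sum_vecMulVec]

/-- `treeDiagonalContractions n`: the operators `∑_y ε_y |e_y⟩⟨e_y|` with `e` an LOCC-tree
orthonormal product basis of `n` qubits and `|ε_y| ≤ 1` — real-diagonal contractions in a
tree basis; for `ε_y = ±1` these are the operators `2M - 1` of the two-outcome coarse-grainings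
`(M, 1 - M)` of the tree measurement, and `ε ∈ [-1,1]^{2ⁿ}` is their convex relaxation
(Matthews–Wehner–Winter, Lemma 2, for the class of LOCC-tree projective measurements). [folklore] -/
def treeDiagonalContractions (n : ℕ) : Set (Matrix (QReg n) (QReg n) ℂ) :=
  {D | ∃ (e : QReg n → QReg n → ℂ) (ε : QReg n → ℝ),
    IsTreeProductBasis n e ∧ (∀ y, |ε y| ≤ 1) ∧ D = frameDiagonal e ε}

/-- The generating set is symmetric: `-D` is again a tree-diagonal contraction. [folklore] -/
theorem neg_mem_treeDiagonalContractions {n : ℕ} {D : Matrix (QReg n) (QReg n) ℂ}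
    (hD : D ∈ treeDiagonalContractions n) : -D ∈ treeDiagonalContractions n := by
  obtain ⟨e, ε, he, hε, rfl⟩ := hD
  exact ⟨e, -ε, he, fun y => by simpa using hε y, (frameDiagonal_neg e ε).symm⟩

/-- The identity is a tree-diagonal contraction (`ε ≡ 1` on the computational basis). [folklore] -/
theorem one_mem_treeDiagonalContractions (n : ℕ) :
    (1 : Matrix (QReg n) (QReg n) ℂ) ∈ treeDiagonalContractions n :=
  ⟨fun y => basisState y, fun _ => 1, isTreeProductBasis_basisState n,
    fun _ => by simp, (frameDiagonal_one (isTreeProductBasis_basisState n)).symm⟩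

/-- `treeFrameBody n = 𝒫ₙ := conv(treeDiagonalContractions n)`, the symmetric convex body of
operators attached to the LOCC-tree measurement class (Matthews–Wehner–Winter, §1 Lemma 2:
`𝕄 = conv{2M - 1}`); the strong form "`κₙ = 1`" of the route's crux reads `𝒜ₙ = 𝒫ₙ`.
[cite: MatthewsWehnerWinter2009, §1 Lemma 2 (arXiv numbering)] -/
def treeFrameBody (n : ℕ) : Set (Matrix (QReg n) (QReg n) ℂ) :=
  convexHull ℝ (treeDiagonalContractions n)

/-! ### The `ℓ¹`-atomic gauge of a set of operators -/

section AtomicGauge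

variable {E : Type*} [AddCommGroup E] [Module ℂ E]

/-- `atomicWeights 𝒟 x`: the set of `ℓ¹`-weights `∑ₖ |cₖ|` of the finite real decompositions
`x = ∑ₖ cₖ • aₖ` with atoms `aₖ ∈ 𝒟` (real coefficients acting through `ℝ → ℂ`). [folklore] -/
def atomicWeights (𝒟 : Set E) (x : E) : Set ℝ :=
  {r | ∃ (K : ℕ) (c : Fin K → ℝ) (a : Fin K → E),
    (∀ k, a k ∈ 𝒟) ∧ x = ∑ k, ((c k : ℂ)) • a k ∧ r = ∑ k, |c k|}

/-- `atomicGauge 𝒟 x = inf {∑ₖ |cₖ| : x = ∑ₖ cₖ • aₖ, aₖ ∈ 𝒟}` — the atomic (`ℓ¹`) gauge of `x`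
with respect to `𝒟`, i.e. the Minkowski gauge of `conv(𝒟 ∪ -𝒟)` written over finite
decompositions ("`‖M‖ = inf {1/t : t > 0, tM ∈ 𝕄}`", Matthews–Wehner–Winter Remark 3). Junk value
`0 = sInf ∅` when `x` has no decomposition. [folklore] -/
def atomicGauge (𝒟 : Set E) (x : E) : ℝ :=
  sInf (atomicWeights 𝒟 x)

/-- Weights are nonnegative. [folklore] -/
theorem atomicWeights_nonneg {𝒟 : Set E} {x : E} {r : ℝ} (hr : r ∈ atomicWeights 𝒟 x) :
    0 ≤ r := by
  obtain ⟨K, c, a, -, -, rfl⟩ := hr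
  exact Finset.sum_nonneg fun k _ => abs_nonneg _

/-- The gauge is nonnegative (also in the junk case). [folklore] -/
theorem atomicGauge_nonneg (𝒟 : Set E) (x : E) : 0 ≤ atomicGauge 𝒟 x :=
  Real.sInf_nonneg fun _ hr => atomicWeights_nonneg hr

/-- Any explicit decomposition bounds the gauge from above. [folklore] -/
theorem atomicGauge_le {𝒟 : Set E} {x : E} {K : ℕ} (c : Fin K → ℝ) (a : Fin K → E)
    (ha : ∀ k, a k ∈ 𝒟) (hx : x = ∑ k, ((c k : ℂ)) • a k) :
    atomicGauge 𝒟 x ≤ ∑ k, |c k| :=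
  csInf_le ⟨0, fun _ hr => atomicWeights_nonneg hr⟩ ⟨K, c, a, ha, hx, rfl⟩

/-- `atomicGauge 𝒟 0 = 0` (the empty decomposition). [folklore] -/
theorem atomicGauge_zero (𝒟 : Set E) : atomicGauge 𝒟 (0 : E) = 0 := by
  refine le_antisymm ?_ (atomicGauge_nonneg 𝒟 0)
  simpa using atomicGauge_le (𝒟 := 𝒟) (x := (0 : E)) (K := 0)
    (fun k => k.elim0) (fun k => k.elim0) (fun k => k.elim0) (by simp)

end AtomicGauge

/-! ### The tree-frame norm -/

/-- `treeFrameNorm T = a(T) := inf {∑ₖ |cₖ| : T = ∑ₖ cₖ Dₖ, Dₖ ∈ treeDiagonalContractions n}` —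
the **tree-frame norm**: the least `ℓ¹`-weight of a decomposition of `T` into real-diagonal
contractions in adaptive (LOCC-tree) orthonormal product bases, i.e. the gauge of the body
`𝒫ₙ = treeFrameBody n` (Matthews–Wehner–Winter Remark 3 for the LOCC-tree class). Junk value `0`
if `T` has no such decomposition (documented in the module docstring). [folklore] -/
def treeFrameNorm {n : ℕ} (T : Matrix (QReg n) (QReg n) ℂ) : ℝ :=
  atomicGauge (treeDiagonalContractions n) T

/-- Unfolding of `treeFrameNorm`. [folklore] -/
theorem treeFrameNorm_def {n : ℕ} (T : Matrix (QReg n) (QReg n) ℂ) :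
    treeFrameNorm T = sInf (atomicWeights (treeDiagonalContractions n) T) :=
  rfl

/-- `0 ≤ a(T)`. [folklore] -/
theorem treeFrameNorm_nonneg {n : ℕ} (T : Matrix (QReg n) (QReg n) ℂ) : 0 ≤ treeFrameNorm T :=
  atomicGauge_nonneg _ _

/-- An explicit tree-frame decomposition `T = ∑ₖ cₖ Dₖ` bounds `a(T) ≤ ∑ₖ |cₖ|`. [folklore] -/
theorem treeFrameNorm_le {n K : ℕ} {T : Matrix (QReg n) (QReg n) ℂ} (c : Fin K → ℝ)
    (D : Fin K → Matrix (QReg n) (QReg n) ℂ) (hD : ∀ k, D k ∈ treeDiagonalContractions n)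
    (hT : T = ∑ k, ((c k : ℂ)) • D k) : treeFrameNorm T ≤ ∑ k, |c k| :=
  atomicGauge_le c D hD hT

/-- `a(0) = 0`. [folklore] -/
theorem treeFrameNorm_zero (n : ℕ) : treeFrameNorm (0 : Matrix (QReg n) (QReg n) ℂ) = 0 :=
  atomicGauge_zero _

/-- `a(1) ≤ 1`: the identity is itself a tree-diagonal contraction. [folklore] -/
theorem treeFrameNorm_one_le (n : ℕ) : treeFrameNorm (1 : Matrix (QReg n) (QReg n) ℂ) ≤ 1 := by
  simpa using treeFrameNorm_le (T := (1 : Matrix (QReg n) (QReg n) ℂ)) (K := 1) (fun _ => 1)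
    (fun _ => 1) (fun _ => one_mem_treeDiagonalContractions n) (by simp)

/-! ### The two-sided radius of a body in a direction -/

section SymmRadius

variable {A : Type*} [Ring A] [Module ℂ A]

/-- `symmRadius K T = sup {β ≥ 0 : 1 + β • T ∈ K ∧ 1 - β • T ∈ K}` (in `ℝ≥0∞`; real `β` acting
through `ℝ → ℂ`): the two-sided radius of the set `K` at the identity in direction `T`. For `K`
the cone of (fully) separable operators, `{S : 1 + S ∈ K ∧ 1 - S ∈ K}` is the symmetric convex
body `𝕊𝔼ℙ` of Matthews–Wehner–Winter and `symmRadius K T = 1 / ‖T‖` for its gauge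
`‖T‖ = inf {1/t : t > 0, tT ∈ 𝕊𝔼ℙ}`; this is the symmetric separable radius `s_sym(T)` of route
`SeparableFrames` (`sepRadiusSym T := symmRadius (FullySeparableCone n) T`).
[cite: MatthewsWehnerWinter2009, §1 Lemma 2 & Remark 3; §3 (arXiv numbering)] -/
def symmRadius (K : Set A) (T : A) : ℝ≥0∞ :=
  ⨆ (β : ℝ≥0) (_ : 1 + ((β : ℝ) : ℂ) • T ∈ K ∧ 1 - ((β : ℝ) : ℂ) • T ∈ K), (β : ℝ≥0∞)

/-- A two-sided witness `1 ± βT ∈ K` bounds the radius from below. [folklore] -/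
theorem le_symmRadius {K : Set A} {T : A} (β : ℝ≥0)
    (h : 1 + ((β : ℝ) : ℂ) • T ∈ K ∧ 1 - ((β : ℝ) : ℂ) • T ∈ K) :
    (β : ℝ≥0∞) ≤ symmRadius K T :=
  le_iSup₂ (f := fun (β : ℝ≥0) (_ : 1 + ((β : ℝ) : ℂ) • T ∈ K ∧ 1 - ((β : ℝ) : ℂ) • T ∈ K) =>
    (β : ℝ≥0∞)) β h

/-- Real-parameter form of `le_symmRadius`. [folklore] -/
theorem ofReal_le_symmRadius {K : Set A} {T : A} {β : ℝ} (hβ : 0 ≤ β)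
    (h₁ : 1 + (β : ℂ) • T ∈ K) (h₂ : 1 - (β : ℂ) • T ∈ K) :
    ENNReal.ofReal β ≤ symmRadius K T := by
  have h := le_symmRadius (K := K) (T := T) ⟨β, hβ⟩ ⟨h₁, h₂⟩
  rwa [ENNReal.ofReal, Real.toNNReal_of_nonneg hβ]

/-- The radius is monotone in the body. [folklore] -/
theorem symmRadius_mono {K K' : Set A} (hK : K ⊆ K') (T : A) :
    symmRadius K T ≤ symmRadius K' T :=
  iSup₂_le fun β h => le_symmRadius β ⟨hK h.1, hK h.2⟩

/-- In direction `0` every `β` qualifies as soon as `1 ∈ K`, so the radius is `⊤` (faithful,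
not a junk value). [folklore] -/
theorem symmRadius_zero_of_one_mem {K : Set A} (hK : (1 : A) ∈ K) : symmRadius K 0 = ⊤ :=
  ENNReal.eq_top_of_forall_nnreal_le fun β => le_symmRadius β (by simpa using hK)

/-- Conversely `symmRadius K T = 0` unless some positive `β` qualifies: if no `β > 0` has
`1 ± βT ∈ K` then the radius vanishes. [folklore] -/
theorem symmRadius_eq_zero {K : Set A} {T : A}
    (h : ∀ β : ℝ, 0 < β → ¬(1 + (β : ℂ) • T ∈ K ∧ 1 - (β : ℂ) • T ∈ K)) :
    symmRadius K T = 0 := by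
  refine nonpos_iff_eq_zero.mp (iSup₂_le fun β hβ => ?_)
  rcases eq_or_lt_of_le β.2 with h0 | hpos
  · have : β = 0 := Subtype.ext h0.symm
    simp [this]
  · exact absurd hβ (h β hpos)

end SymmRadius

end Literature.Computability.QuantumComplexity
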